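import Mathlib
import Summits.Ventures.PercRepro2.CoinDiamondAlg

/-!
# The OR-tail over two independent log-supermodular branches: the abstract functional
(blind cell PercRepro2, night-2 g9; proofs/NIGHT2-DARC.md §35)

`orTail_functional_nonneg`: let `U` be a finite vertex set carrying a log-supermodular weight `ν`
(the cluster law of the two branches together), two markers `p, q ∈ U`, a tail vertex `a ∉ U`
entered from `p` with probability `ρ` and from `q` with probability `τ` (independent coins), a
phantom `w ∉ U` («`w` entered surely»), and a decreasing log-supermodular head function `A` on
the subsets of `U ∪ {a, w}`.  Then the cleared functional of row 2′DARC,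
`Λ² XY_G − Λ F_a Y_G − Λ F_b X_G + F_a F_b M_G`, built from the `R`-values
`g W · A W + (1 − g W) · A (W ∪ {a})` and the gate values `g W · A W + (1 − g W) · A (W ∪ {a, w})`
(`g W = (1 − ρ·1[p ∈ W])(1 − τ·1[q ∈ W])` = the probability that `a` is NOT entered), is
nonnegative.

The proof is CELL-AVERAGING: the four `(p, q)`-membership cells of `U` play the role of the four
root clusters `∅, p, q, pq` of the directed diamond, the eleven cell sums
`cellSum … bp bq X = Σ_W ν W · 1[cell] · A (W ∪ X)` (`X ∈ {∅, {a}, {a, w}}`) play the role of its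
eleven head values, the seven moments are LITERALLY the diamond's seven moments in these sums
(`α = α' = β = β' = 1`), and the diamond's eleven log-supermodular steps hold for the cell sums by
the Ahlswede–Daykin four functions theorem (`Finset.four_functions_theorem`: the weight `ν` and
the head `A` are log-supermodular and the cells are compatible with `∩, ∪`), the eight
monotonicity steps termwise.  `diamond_cert` (the 272-term certificate, in the tree) closes.
-/

namespace Summit.Ventures.PercRepro2.Coin

section OrTailAlg

variable {V : Type*} [DecidableEq V] {R : Type*} [Field R] [LinearOrder R] [IsStrictOrderedRing R]

/-- The membership weight of one marker: `1` if `p ∈ W ⟺ b`, `0` otherwise. -/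
def mWt (p : V) (b : Bool) (W : Finset V) : R := if (p ∈ W ↔ b = true) then 1 else 0

/-- The cell weight of the pattern `(bp, bq)`: `1` on the sets `W` with `p ∈ W ⟺ bp`,
`q ∈ W ⟺ bq`, else `0`. -/
def cellWt (p q : V) (bp bq : Bool) (W : Finset V) : R := mWt p bp W * mWt q bq W

/-- A cell sum: `Σ_{W ⊆ U} ν W · cellWt bp bq W · A (W ∪ X)`. -/
def cellSum (U : Finset V) (ν A : Finset V → R) (p q : V) (bp bq : Bool) (X : Finset V) : R :=
  ∑ W ∈ U.powerset, ν W * cellWt (R := R) p q bp bq W * A (W ∪ X)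

omit [LinearOrder R] [IsStrictOrderedRing R] in
/-- `mWt` unfolded. -/
lemma mWt_apply (p : V) (b : Bool) (W : Finset V) :
    mWt (R := R) p b W = if (p ∈ W ↔ b = true) then 1 else 0 := rfl

/-- `mWt` is nonnegative. -/
lemma mWt_nonneg (p : V) (b : Bool) (W : Finset V) : 0 ≤ mWt (R := R) p b W := by
  unfold mWt; split_ifs <;> norm_num

/-- `cellWt` is nonnegative. -/
lemma cellWt_nonneg (p q : V) (bp bq : Bool) (W : Finset V) :
    0 ≤ cellWt (R := R) p q bp bq W :=
  mul_nonneg (mWt_nonneg _ _ _) (mWt_nonneg _ _ _)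

/-- The membership weights are compatible with `∩` and `∪`: the product of the weights of `s`
and `t` is at most the product of the weights of `s ∩ t` (pattern `b && b'`) and `s ∪ t`
(pattern `b || b'`) — with equality when both are `1`. -/
lemma mWt_mul_le (p : V) (b b' : Bool) (s t : Finset V) :
    mWt (R := R) p b s * mWt p b' t ≤ mWt p (b && b') (s ∩ t) * mWt p (b || b') (s ∪ t) := by
  unfold mWt
  cases b <;> cases b' <;> by_cases hs : p ∈ s <;> by_cases ht : p ∈ t <;>
    simp [hs, ht, Finset.mem_inter, Finset.mem_union]

/-- The cell weights are compatible with `∩` and `∪`. -/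
lemma cellWt_mul_le (p q : V) (bp bq bp' bq' : Bool) (s t : Finset V) :
    cellWt (R := R) p q bp bq s * cellWt p q bp' bq' t ≤
      cellWt p q (bp && bp') (bq && bq') (s ∩ t) * cellWt p q (bp || bp') (bq || bq') (s ∪ t) := by
  unfold cellWt
  calc mWt (R := R) p bp s * mWt q bq s * (mWt p bp' t * mWt q bq' t)
      = (mWt p bp s * mWt p bp' t) * (mWt q bq s * mWt q bq' t) := by ring
    _ ≤ (mWt p (bp && bp') (s ∩ t) * mWt p (bp || bp') (s ∪ t)) *
          (mWt q (bq && bq') (s ∩ t) * mWt q (bq || bq') (s ∪ t)) :=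
        mul_le_mul (mWt_mul_le p bp bp' s t) (mWt_mul_le q bq bq' s t)
          (mul_nonneg (mWt_nonneg _ _ _) (mWt_nonneg _ _ _))
          (mul_nonneg (mWt_nonneg _ _ _) (mWt_nonneg _ _ _))
    _ = mWt p (bp && bp') (s ∩ t) * mWt q (bq && bq') (s ∩ t) *
          (mWt p (bp || bp') (s ∪ t) * mWt q (bq || bq') (s ∪ t)) := by ring

omit [LinearOrder R] [IsStrictOrderedRing R] in
/-- The two unions with bits outside `U` intersect cellwise. -/
lemma union_inter_union_of_disjoint {U s t X Y : Finset V} (hs : s ⊆ U) (ht : t ⊆ U)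
    (hXU : Disjoint X U) (hYU : Disjoint Y U) :
    (s ∪ X) ∩ (t ∪ Y) = (s ∩ t) ∪ (X ∩ Y) := by
  ext x
  simp only [Finset.mem_inter, Finset.mem_union]
  constructor
  · rintro ⟨hx1 | hx1, hx2 | hx2⟩
    · exact Or.inl ⟨hx1, hx2⟩
    · exact absurd (hs hx1) (Finset.disjoint_left.1 hYU hx2)
    · exact absurd (ht hx2) (Finset.disjoint_left.1 hXU hx1)
    · exact Or.inr ⟨hx1, hx2⟩
  · rintro (⟨hx1, hx2⟩ | ⟨hx1, hx2⟩)
    · exact ⟨Or.inl hx1, Or.inl hx2⟩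
    · exact ⟨Or.inr hx1, Or.inr hx2⟩

omit [LinearOrder R] [IsStrictOrderedRing R] in
/-- The two unions with bits outside `U` unite cellwise. -/
lemma union_union_union_eq {s t X Y : Finset V} :
    (s ∪ X) ∪ (t ∪ Y) = (s ∪ t) ∪ (X ∪ Y) := by
  ext x; simp only [Finset.mem_union]; tauto

/-- **The log-supermodular step of the cell sums** (Ahlswede–Daykin): for a log-supermodular
weight `ν` on the subsets of `U`, a log-supermodular head `A`, and bit sets `X, Y` disjoint from
`U`, the product of two cell sums is at most the product of the cell sums of the meet
(pattern `&&`, bits `X ∩ Y`) and the join (pattern `||`, bits `X ∪ Y`). -/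
theorem cellSum_mul_le (U : Finset V) (ν A : Finset V → R) (p q : V)
    (hν0 : ∀ W, 0 ≤ ν W) (hν : ∀ s ⊆ U, ∀ t ⊆ U, ν s * ν t ≤ ν (s ∩ t) * ν (s ∪ t))
    (hA0 : ∀ W, 0 ≤ A W) (hA : ∀ s t : Finset V, A s * A t ≤ A (s ∩ t) * A (s ∪ t))
    (bp bq bp' bq' : Bool) (X Y : Finset V) (hXU : Disjoint X U) (hYU : Disjoint Y U) :
    cellSum U ν A p q bp bq X * cellSum U ν A p q bp' bq' Y ≤
      cellSum U ν A p q (bp && bp') (bq && bq') (X ∩ Y) *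
        cellSum U ν A p q (bp || bp') (bq || bq') (X ∪ Y) := by
  unfold cellSum
  have h₁ : (0 : Finset V → R) ≤ fun W => ν W * cellWt p q bp bq W * A (W ∪ X) :=
    fun W => mul_nonneg (mul_nonneg (hν0 W) (cellWt_nonneg _ _ _ _ _)) (hA0 _)
  have h₂ : (0 : Finset V → R) ≤ fun W => ν W * cellWt p q bp' bq' W * A (W ∪ Y) :=
    fun W => mul_nonneg (mul_nonneg (hν0 W) (cellWt_nonneg _ _ _ _ _)) (hA0 _)
  have h₃ : (0 : Finset V → R) ≤
      fun W => ν W * cellWt p q (bp && bp') (bq && bq') W * A (W ∪ (X ∩ Y)) :=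
    fun W => mul_nonneg (mul_nonneg (hν0 W) (cellWt_nonneg _ _ _ _ _)) (hA0 _)
  have h₄ : (0 : Finset V → R) ≤
      fun W => ν W * cellWt p q (bp || bp') (bq || bq') W * A (W ∪ (X ∪ Y)) :=
    fun W => mul_nonneg (mul_nonneg (hν0 W) (cellWt_nonneg _ _ _ _ _)) (hA0 _)
  have h : ∀ ⦃s : Finset V⦄, s ⊆ U → ∀ ⦃t : Finset V⦄, t ⊆ U →
      (fun W => ν W * cellWt p q bp bq W * A (W ∪ X)) s *
        (fun W => ν W * cellWt p q bp' bq' W * A (W ∪ Y)) t ≤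
      (fun W => ν W * cellWt p q (bp && bp') (bq && bq') W * A (W ∪ (X ∩ Y))) (s ∩ t) *
        (fun W => ν W * cellWt p q (bp || bp') (bq || bq') W * A (W ∪ (X ∪ Y))) (s ∪ t) := by
    intro s hs t ht
    simp only
    have hAA : A (s ∪ X) * A (t ∪ Y) ≤ A ((s ∩ t) ∪ (X ∩ Y)) * A ((s ∪ t) ∪ (X ∪ Y)) := by
      have := hA (s ∪ X) (t ∪ Y)
      rwa [union_inter_union_of_disjoint hs ht hXU hYU, union_union_union_eq] at this
    calc ν s * cellWt p q bp bq s * A (s ∪ X) * (ν t * cellWt p q bp' bq' t * A (t ∪ Y))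
        = (ν s * ν t) * (cellWt p q bp bq s * cellWt p q bp' bq' t) *
            (A (s ∪ X) * A (t ∪ Y)) := by ring
      _ ≤ (ν (s ∩ t) * ν (s ∪ t)) *
            (cellWt p q (bp && bp') (bq && bq') (s ∩ t) * cellWt p q (bp || bp') (bq || bq') (s ∪ t)) *
            (A ((s ∩ t) ∪ (X ∩ Y)) * A ((s ∪ t) ∪ (X ∪ Y))) := by
          apply mul_le_mul
          · apply mul_le_mul (hν s hs t ht) (cellWt_mul_le p q bp bq bp' bq' s t)
            · exact mul_nonneg (cellWt_nonneg _ _ _ _ _) (cellWt_nonneg _ _ _ _ _)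
            · exact mul_nonneg (hν0 _) (hν0 _)
          · exact hAA
          · exact mul_nonneg (hA0 _) (hA0 _)
          · exact mul_nonneg (mul_nonneg (hν0 _) (hν0 _))
              (mul_nonneg (cellWt_nonneg _ _ _ _ _) (cellWt_nonneg _ _ _ _ _))
      _ = ν (s ∩ t) * cellWt p q (bp && bp') (bq && bq') (s ∩ t) * A ((s ∩ t) ∪ (X ∩ Y)) *
            (ν (s ∪ t) * cellWt p q (bp || bp') (bq || bq') (s ∪ t) * A ((s ∪ t) ∪ (X ∪ Y))) := by
          ring
  have key := Finset.four_functions_theorem U h₁ h₂ h₃ h₄ h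
    (𝒜 := U.powerset) (ℬ := U.powerset) le_rfl le_rfl
  simpa only [Finset.powerset_infs_powerset_self, Finset.powerset_sups_powerset_self] using key

/-- **The monotone step of the cell sums**: more bits, smaller head values. -/
theorem cellSum_mono (U : Finset V) (ν A : Finset V → R) (p q : V)
    (hν0 : ∀ W, 0 ≤ ν W) (hAmono : ∀ s t : Finset V, s ⊆ t → A t ≤ A s)
    (bp bq : Bool) (X Y : Finset V) (hXY : X ⊆ Y) :
    cellSum U ν A p q bp bq Y ≤ cellSum U ν A p q bp bq X := by
  unfold cellSum
  apply Finset.sum_le_sum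
  intro W _
  exact mul_le_mul_of_nonneg_left (hAmono _ _ (Finset.union_subset_union_right hXY))
    (mul_nonneg (hν0 W) (cellWt_nonneg _ _ _ _ _))

/-- The cell sums are nonnegative. -/
lemma cellSum_nonneg (U : Finset V) (ν A : Finset V → R) (p q : V)
    (hν0 : ∀ W, 0 ≤ ν W) (hA0 : ∀ W, 0 ≤ A W) (bp bq : Bool) (X : Finset V) :
    0 ≤ cellSum U ν A p q bp bq X :=
  Finset.sum_nonneg fun W _ =>
    mul_nonneg (mul_nonneg (hν0 W) (cellWt_nonneg _ _ _ _ _)) (hA0 _)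

/-- The tail weight `g W = (1 − ρ·1[p ∈ W])·(1 − τ·1[q ∈ W])`: the probability that the tail
`a` is not entered from the cluster `W`. -/
def tailWt (p q : V) (ρ τ : R) (W : Finset V) : R :=
  (1 - ρ * (if p ∈ W then 1 else 0)) * (1 - τ * (if q ∈ W then 1 else 0))

/-- The `R`-value of the cluster `W`: the head value averaged over the tail bit. -/
def rVal (A : Finset V → R) (p q a : V) (ρ τ : R) (W : Finset V) : R :=
  tailWt p q ρ τ W * A W + (1 - tailWt p q ρ τ W) * A (W ∪ {a})

/-- The gate value of the cluster `W`: as `rVal`, with `w` added whenever the tail is entered. -/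
def gVal (A : Finset V → R) (p q a w : V) (ρ τ : R) (W : Finset V) : R :=
  tailWt p q ρ τ W * A W + (1 - tailWt p q ρ τ W) * A (W ∪ {a, w})

omit [LinearOrder R] [IsStrictOrderedRing R] in
/-- `{a} ∩ {a, w} = {a}`. -/
lemma singleton_inter_pair (a w : V) : ({a} : Finset V) ∩ {a, w} = {a} := by
  ext x; simp only [Finset.mem_inter, Finset.mem_singleton, Finset.mem_insert]; tauto

omit [LinearOrder R] [IsStrictOrderedRing R] in
/-- `{a} ∪ {a, w} = {a, w}`. -/
lemma singleton_union_pair (a w : V) : ({a} : Finset V) ∪ {a, w} = {a, w} := by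
  ext x; simp only [Finset.mem_union, Finset.mem_singleton, Finset.mem_insert]; tauto

/-- **THE OR-TAIL FUNCTIONAL IS NONNEGATIVE** (cell-averaging + Ahlswede–Daykin +
`diamond_cert`).  Hypotheses: `a, w ∉ U`; `ρ, τ ∈ [0, 1]`; `ν ≥ 0` log-supermodular on
the subsets of `U`; `A ≥ 0` decreasing and log-supermodular.  Conclusion: the cleared functional
`Λ² XY_G − Λ F_a Y_G − Λ F_b X_G + F_a F_b M_G ≥ 0` with
`Λ = Σ ν·rVal`, `F_a = Σ ν·rVal·x`, `F_b = Σ ν·rVal·y`, `M_G = Σ ν·gVal`, `X_G = Σ ν·gVal·x`,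
`Y_G = Σ ν·gVal·y`, `XY_G = Σ ν·gVal·x·y` (sums over `W ⊆ U`, `x = 1[p ∈ W]`, `y = 1[q ∈ W]`). -/
theorem orTail_functional_nonneg (U : Finset V) (ν A : Finset V → R) (p q a w : V) (ρ τ : R)
    (haU : a ∉ U) (hwU : w ∉ U)
    (hρ0 : 0 ≤ ρ) (hρ1 : ρ ≤ 1) (hτ0 : 0 ≤ τ) (hτ1 : τ ≤ 1)
    (hν0 : ∀ W, 0 ≤ ν W) (hν : ∀ s ⊆ U, ∀ t ⊆ U, ν s * ν t ≤ ν (s ∩ t) * ν (s ∪ t))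
    (hA0 : ∀ W, 0 ≤ A W) (hA : ∀ s t : Finset V, A s * A t ≤ A (s ∩ t) * A (s ∪ t))
    (hAmono : ∀ s t : Finset V, s ⊆ t → A t ≤ A s) :
    0 ≤ (∑ W ∈ U.powerset, ν W * rVal A p q a ρ τ W) ^ 2 *
          (∑ W ∈ U.powerset, ν W * gVal A p q a w ρ τ W *
            ((if p ∈ W then (1 : R) else 0) * (if q ∈ W then (1 : R) else 0)))
        - (∑ W ∈ U.powerset, ν W * rVal A p q a ρ τ W) *
          (∑ W ∈ U.powerset, ν W * rVal A p q a ρ τ W * (if p ∈ W then (1 : R) else 0)) *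
          (∑ W ∈ U.powerset, ν W * gVal A p q a w ρ τ W * (if q ∈ W then (1 : R) else 0))
        - (∑ W ∈ U.powerset, ν W * rVal A p q a ρ τ W) *
          (∑ W ∈ U.powerset, ν W * rVal A p q a ρ τ W * (if q ∈ W then (1 : R) else 0)) *
          (∑ W ∈ U.powerset, ν W * gVal A p q a w ρ τ W * (if p ∈ W then (1 : R) else 0))
        + (∑ W ∈ U.powerset, ν W * rVal A p q a ρ τ W * (if p ∈ W then (1 : R) else 0)) *
          (∑ W ∈ U.powerset, ν W * rVal A p q a ρ τ W * (if q ∈ W then (1 : R) else 0)) *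
          (∑ W ∈ U.powerset, ν W * gVal A p q a w ρ τ W) := by
  -- the eleven cell sums
  set S0 := cellSum U ν A p q false false ∅ with hS0
  set Sp := cellSum U ν A p q true false ∅ with hSp
  set Sq := cellSum U ν A p q false true ∅ with hSq
  set Spq := cellSum U ν A p q true true ∅ with hSpq
  set Spa := cellSum U ν A p q true false {a} with hSpa
  set Sqa := cellSum U ν A p q false true {a} with hSqa
  set Spqa := cellSum U ν A p q true true {a} with hSpqa
  set Sa := cellSum U ν A p q false false {a} with hSa
  set Bpa := cellSum U ν A p q true false {a, w} with hBpa
  set Bqa := cellSum U ν A p q false true {a, w} with hBqa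
  set Bpqa := cellSum U ν A p q true true {a, w} with hBpqa
  have hXa : Disjoint ({a} : Finset V) U := Finset.disjoint_singleton_left.2 haU
  have hXaw : Disjoint ({a, w} : Finset V) U := by
    rw [Finset.disjoint_left]
    intro x hx
    simp only [Finset.mem_insert, Finset.mem_singleton] at hx
    rcases hx with rfl | rfl
    · exact haU
    · exact hwU
  have hX0 : Disjoint (∅ : Finset V) U := Finset.disjoint_empty_left U
  -- the eleven log-supermodular steps
  have L := cellSum_mul_le U ν A p q hν0 hν hA0 hA
  have hl1 : Spa * Bqa ≤ Sa * Bpqa := by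
    have := L true false false true {a} {a, w} hXa hXaw
    simpa only [Bool.and_false, Bool.false_and, Bool.true_or, Bool.or_true,
      singleton_inter_pair, singleton_union_pair] using this
  have hl2 : Spqa * Bpa ≤ Spa * Bpqa := by
    have := L true true true false {a} {a, w} hXa hXaw
    simpa only [Bool.and_self, Bool.and_false, Bool.or_self, Bool.true_or,
      singleton_inter_pair, singleton_union_pair] using this
  have hl3 : Spqa * Bqa ≤ Sqa * Bpqa := by
    have := L true true false true {a} {a, w} hXa hXaw
    simpa only [Bool.and_self, Bool.and_false, Bool.or_self, Bool.true_or,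
      singleton_inter_pair, singleton_union_pair] using this
  have hl4 : Sqa * Bpa ≤ Sa * Bpqa := by
    have := L false true true false {a} {a, w} hXa hXaw
    simpa only [Bool.and_false, Bool.false_and, Bool.true_or, Bool.false_or,
      singleton_inter_pair, singleton_union_pair] using this
  have hl5 : Sp * Sqa ≤ S0 * Spqa := by
    have := L true false false true ∅ {a} hX0 hXa
    simpa only [Bool.and_false, Bool.false_and, Bool.true_or, Bool.false_or,
      Finset.empty_inter, Finset.empty_union] using this
  have hl6 : Sp * Bqa ≤ S0 * Bpqa := by
    have := L true false false true ∅ {a, w} hX0 hXaw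
    simpa only [Bool.and_false, Bool.false_and, Bool.true_or, Bool.false_or,
      Finset.empty_inter, Finset.empty_union] using this
  have hl7 : Sp * Sq ≤ S0 * Spq := by
    have := L true false false true ∅ ∅ hX0 hX0
    simpa only [Bool.and_false, Bool.false_and, Bool.true_or, Bool.false_or,
      Finset.empty_inter, Finset.empty_union] using this
  have hl8 : Spq * Bpa ≤ Sp * Bpqa := by
    have := L true true true false ∅ {a, w} hX0 hXaw
    simpa only [Bool.and_self, Bool.and_false, Bool.or_self, Bool.true_or,
      Finset.empty_inter, Finset.empty_union] using this
  have hl9 : Spq * Bqa ≤ Sq * Bpqa := by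
    have := L true true false true ∅ {a, w} hX0 hXaw
    simpa only [Bool.and_self, Bool.and_false, Bool.or_self, Bool.true_or,
      Finset.empty_inter, Finset.empty_union] using this
  have hl10 : Sq * Spa ≤ S0 * Spqa := by
    have := L false true true false ∅ {a} hX0 hXa
    simpa only [Bool.and_false, Bool.false_and, Bool.true_or, Bool.false_or,
      Finset.empty_inter, Finset.empty_union] using this
  have hl11 : Sq * Bpa ≤ S0 * Bpqa := by
    have := L false true true false ∅ {a, w} hX0 hXaw
    simpa only [Bool.and_false, Bool.false_and, Bool.true_or, Bool.false_or,
      Finset.empty_inter, Finset.empty_union] using this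
  -- the eight monotone steps
  have M := cellSum_mono U ν A p q hν0 hAmono
  have ha_aw : ({a} : Finset V) ⊆ {a, w} := by simp
  have h0_a : (∅ : Finset V) ⊆ {a} := Finset.empty_subset _
  have h0_aw : (∅ : Finset V) ⊆ {a, w} := Finset.empty_subset _
  have hm1 : Bpa ≤ Spa := M true false {a} {a, w} ha_aw
  have hm2 : Bqa ≤ Sqa := M false true {a} {a, w} ha_aw
  have hm3 : Sa ≤ S0 := M false false ∅ {a} h0_a
  have hm4 : Spa ≤ Sp := M true false ∅ {a} h0_a
  have hm5 : Bpa ≤ Sp := M true false ∅ {a, w} h0_aw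
  have hm6 : Spqa ≤ Spq := M true true ∅ {a} h0_a
  have hm7 : Sqa ≤ Sq := M false true ∅ {a} h0_a
  have hm8 : Bqa ≤ Sq := M false true ∅ {a, w} h0_aw
  have N := cellSum_nonneg U ν A p q hν0 hA0
  -- the diamond certificate on the cell sums
  have key := diamond_cert (1 : R) 1 1 1 ρ (1 - ρ) τ (1 - τ) S0 Sp Sq Spq Spa Sqa Spqa Sa Bpa Bqa
    Bpqa zero_le_one zero_le_one zero_le_one zero_le_one hρ0 (sub_nonneg.2 hρ1) hτ0
    (sub_nonneg.2 hτ1) (N _ _ _) (N _ _ _) (N _ _ _) (N _ _ _) (N _ _ _) (N _ _ _) (N _ _ _)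
    (N _ _ _) (N _ _ _) (N _ _ _) hl1 hl2 hl3 hl4 hl5 hl6 hl7 hl8 hl9 hl10 hl11 hm1 hm2 hm3 hm4
    hm5 hm6 hm7 hm8
  -- the seven moments as combinations of the cell sums
  have hpt : ∀ W ∈ U.powerset,
      ν W * rVal A p q a ρ τ W =
        ν W * cellWt p q false false W * A (W ∪ ∅) + (1 - ρ) * (ν W * cellWt p q true false W * A (W ∪ ∅))
        + (1 - τ) * (ν W * cellWt p q false true W * A (W ∪ ∅))
        + (1 - ρ) * (1 - τ) * (ν W * cellWt p q true true W * A (W ∪ ∅))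
        + ρ * (ν W * cellWt p q true false W * A (W ∪ {a}))
        + τ * (ν W * cellWt p q false true W * A (W ∪ {a}))
        + (ρ * τ + ρ * (1 - τ) + (1 - ρ) * τ) * (ν W * cellWt p q true true W * A (W ∪ {a})) := by
    intro W _
    simp only [rVal, tailWt, cellWt, mWt, Finset.union_empty]
    by_cases hp : p ∈ W <;> by_cases hq : q ∈ W <;> simp [hp, hq] <;> ring
  have hpg : ∀ W ∈ U.powerset,
      ν W * gVal A p q a w ρ τ W =
        ν W * cellWt p q false false W * A (W ∪ ∅) + (1 - ρ) * (ν W * cellWt p q true false W * A (W ∪ ∅))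
        + (1 - τ) * (ν W * cellWt p q false true W * A (W ∪ ∅))
        + (1 - ρ) * (1 - τ) * (ν W * cellWt p q true true W * A (W ∪ ∅))
        + ρ * (ν W * cellWt p q true false W * A (W ∪ {a, w}))
        + τ * (ν W * cellWt p q false true W * A (W ∪ {a, w}))
        + (ρ * τ + ρ * (1 - τ) + (1 - ρ) * τ) * (ν W * cellWt p q true true W * A (W ∪ {a, w})) := by
    intro W _
    simp only [gVal, tailWt, cellWt, mWt, Finset.union_empty]
    by_cases hp : p ∈ W <;> by_cases hq : q ∈ W <;> simp [hp, hq] <;> ring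
  have hΛ : ∑ W ∈ U.powerset, ν W * rVal A p q a ρ τ W =
      S0 + (1 - ρ) * Sp + (1 - τ) * Sq + (1 - ρ) * (1 - τ) * Spq + ρ * Spa + τ * Sqa
        + (ρ * τ + ρ * (1 - τ) + (1 - ρ) * τ) * Spqa := by
    simp only [hS0, hSp, hSq, hSpq, hSpa, hSqa, hSpqa, cellSum, Finset.mul_sum,
      ← Finset.sum_add_distrib]
    exact Finset.sum_congr rfl hpt
  have hFa : ∑ W ∈ U.powerset, ν W * rVal A p q a ρ τ W * (if p ∈ W then (1 : R) else 0) =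
      (1 - ρ) * Sp + (1 - ρ) * (1 - τ) * Spq + ρ * Spa
        + (ρ * τ + ρ * (1 - τ) + (1 - ρ) * τ) * Spqa := by
    simp only [hSp, hSpq, hSpa, hSpqa, cellSum, Finset.mul_sum, ← Finset.sum_add_distrib]
    refine Finset.sum_congr rfl fun W hW => ?_
    rw [hpt W hW]
    simp only [cellWt, mWt, Finset.union_empty]
    by_cases hp : p ∈ W <;> by_cases hq : q ∈ W <;> simp [hp, hq]
  have hFb : ∑ W ∈ U.powerset, ν W * rVal A p q a ρ τ W * (if q ∈ W then (1 : R) else 0) =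
      (1 - τ) * Sq + (1 - ρ) * (1 - τ) * Spq + τ * Sqa
        + (ρ * τ + ρ * (1 - τ) + (1 - ρ) * τ) * Spqa := by
    simp only [hSq, hSpq, hSqa, hSpqa, cellSum, Finset.mul_sum, ← Finset.sum_add_distrib]
    refine Finset.sum_congr rfl fun W hW => ?_
    rw [hpt W hW]
    simp only [cellWt, mWt, Finset.union_empty]
    by_cases hp : p ∈ W <;> by_cases hq : q ∈ W <;> simp [hp, hq]
  have hM : ∑ W ∈ U.powerset, ν W * gVal A p q a w ρ τ W =
      S0 + (1 - ρ) * Sp + (1 - τ) * Sq + (1 - ρ) * (1 - τ) * Spq + ρ * Bpa + τ * Bqa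
        + (ρ * τ + ρ * (1 - τ) + (1 - ρ) * τ) * Bpqa := by
    simp only [hS0, hSp, hSq, hSpq, hBpa, hBqa, hBpqa, cellSum, Finset.mul_sum,
      ← Finset.sum_add_distrib]
    exact Finset.sum_congr rfl hpg
  have hX : ∑ W ∈ U.powerset, ν W * gVal A p q a w ρ τ W * (if p ∈ W then (1 : R) else 0) =
      (1 - ρ) * Sp + (1 - ρ) * (1 - τ) * Spq + ρ * Bpa
        + (ρ * τ + ρ * (1 - τ) + (1 - ρ) * τ) * Bpqa := by
    simp only [hSp, hSpq, hBpa, hBpqa, cellSum, Finset.mul_sum, ← Finset.sum_add_distrib]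
    refine Finset.sum_congr rfl fun W hW => ?_
    rw [hpg W hW]
    simp only [cellWt, mWt, Finset.union_empty]
    by_cases hp : p ∈ W <;> by_cases hq : q ∈ W <;> simp [hp, hq]
  have hY : ∑ W ∈ U.powerset, ν W * gVal A p q a w ρ τ W * (if q ∈ W then (1 : R) else 0) =
      (1 - τ) * Sq + (1 - ρ) * (1 - τ) * Spq + τ * Bqa
        + (ρ * τ + ρ * (1 - τ) + (1 - ρ) * τ) * Bpqa := by
    simp only [hSq, hSpq, hBqa, hBpqa, cellSum, Finset.mul_sum, ← Finset.sum_add_distrib]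
    refine Finset.sum_congr rfl fun W hW => ?_
    rw [hpg W hW]
    simp only [cellWt, mWt, Finset.union_empty]
    by_cases hp : p ∈ W <;> by_cases hq : q ∈ W <;> simp [hp, hq]
  have hXY : ∑ W ∈ U.powerset, ν W * gVal A p q a w ρ τ W *
      ((if p ∈ W then (1 : R) else 0) * (if q ∈ W then (1 : R) else 0)) =
      (1 - ρ) * (1 - τ) * Spq + (ρ * τ + ρ * (1 - τ) + (1 - ρ) * τ) * Bpqa := by
    simp only [hSpq, hBpqa, cellSum, Finset.mul_sum, ← Finset.sum_add_distrib]
    refine Finset.sum_congr rfl fun W hW => ?_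
    rw [hpg W hW]
    simp only [cellWt, mWt, Finset.union_empty]
    by_cases hp : p ∈ W <;> by_cases hq : q ∈ W <;> simp [hp, hq]
  rw [hΛ, hFa, hFb, hM, hX, hY, hXY]
  linear_combination key

end OrTailAlg

end Summit.Ventures.PercRepro2.Coin
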